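import Summits.AtomisticToContinuum.Crystallization.Theorems.ChartedZeroExcessLayeredLatticeLiouvilleUC

/-!
# Zero-excess layered lattice Liouville — part UD (lens-2 g44, node «CoherentBasin» beneath [CC] `TameGscCaccioppoliPG`):
# (α) strength audit of [CC] — a hidden POINTWISE clause (PROVED); (β) the line re-seamed from the strictly weaker residual
# [CC°] `TameGscCaccioppoliFloorPG` (radius floor; `[CC] ⇒ [CC°]` and `[KS] ∧ [CC°] ⇒ [C_T]` PROVED); (γ) the special/generic cut
# `[CC°] ⟸ [W] CoherentWindowPG ∧ [CC°_W] CoherentGscCaccioppoliPG` (seam PROVED)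

Line `_16XH19(_tol)` of statement 26636, (M)-side, after part UC: (R_W) ⟸ (K) ∧ (M) ⟸ Gehring-leaf ∧ [T] ∧ [KS] ∧ [CC], every seam proved;
the residual is [CC] `TameGscCaccioppoliPG ϑ` (e⋆-GSC Caccioppoli inequality modulo nearby rigid motions, background floor, tame windows).
(α) AUDIT.  Door sets are `δ`-separated, so at `r = δ/2` the balls `S ∩ B(x,r) ⊆ S ∩ B(x,3r/2) ⊆ S ∩ B(x,2r)` are `{x}`; at the rigid motion
`(1, Ψ' x − x)` the deviation vanishes and [CC] (ii♭) reads `σ x² ≤ c₁·A·η` for EVERY site of the open window `S ∩ ball 0 (8R)`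
(`sq_le_floor_of_caccioppoli_clause`): [CC] as typed also asserts POINTWISE `√η`-flatness of the re-registration's strain (`L^∞` ε-regularity
with linear rate), which the line never uses — [C]/[C_T] (ii) below a fixed radius `r₀` is automatic by packing.
(β) RE-TYPING.  [CC°] `TameGscCaccioppoliFloorPG ϑ` := [CC] VERBATIM with a radius floor `r₀ ≤ r` in (ii♭), `∃ r₀ > 0` among the constants
(provider's choice, uniform in `η, R`).  `[CC] ⇒ [CC°]` and the seam `[KS] ∧ [CC°] ⇒ [C_T]` (new small-ball branch, `b := (9/4)·c₁·C_KS +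
324·C_KS/κ + N₀^{1/d}`, `N₀ := (4r₀/δ + 1)³`) are PROVED: the line runs on the strictly weaker residual [CC°], the pointwise clause is gone.
(γ) THE CUT (lens = special/generic on CONFIGURATIONS, exhaustion by exclusion, `Ψ'` shared — part UC's pattern one amplitude level down).
SPECIAL = the PERTURBATIVE BASIN: windows whose every star is `ϑ₁`-close to a chart star rotated by at most `ω₁` AWAY FROM THE CHART ORIENTATION
(`IsCoherentOn ϑ₁ ω₁`: COOL and CO-ROTATED; intrinsic given the chart lattice, registration-free, via the tree's `tilt`), where lattice elasticity
LINEARISED about the equilibrium chart owns the Caccioppoli inequality — [CC°_W] `CoherentGscCaccioppoliPG ϑ` is [CC°] with the coherence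
hypothesis, the basin `(ϑ₁, ω₁)` OF THE PROVER'S CHOICE (no constant matched across the seam).  GENERIC = tame windows with a WARM star (misfit in
`(ϑ₁, ϑ]`) or a WOUND region (fitting rotation tilted `> ω₁`): excluded outright by [W] `CoherentWindowPG ϑ` («below the hot threshold there is no
intermediate local state», qualitative, census-instrumentable).  Seams `[W] ∧ [CC°_W] ⇒ [CC°]` (thresholds `min/max`) and `[CC°] ⇒ [CC°_W]` PROVED.
Record literals `(aHi; Λ, θ, s; ϑ) = (1; 2, 1/16, 1/50; tameRadius)`; no literature claim is made by the three Props.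
-/

noncomputable section

open scoped BigOperators
open MeasureTheory Set Metric Filter Topology
open Summit.AtomisticToContinuum.Crystallization.Theorems.ChartedPlanarOrderRigidityDoor (E3 atomsIn)
open Summit.AtomisticToContinuum.Crystallization.Theorems.ChartedPlanarOrderDensityDichotomy (μS IsSep nK nK_nonneg)
open Summit.AtomisticToContinuum.Crystallization.Theorems.ChartedPlanarOrderCleanScaleP (IsCleanP IsDoorSetP)
open Summit.AtomisticToContinuum.Crystallization.Theorems.ChartedPlanarOrderMesoCut (LayeredHom EnvClose)
open Summit.AtomisticToContinuum.Crystallization.Theorems.ChartedPlanarOrderDoorLayered (atomsIn_subset)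
open Summit.AtomisticToContinuum.Crystallization.Theorems.ChartedPlanarOrderDoorLayeredOsc (IsTwoShellAffineGood)
open Literature.Analysis.PDE (finavg ZatorskaGoldstein2005_localGehringLemmaCounting)

namespace Summit.AtomisticToContinuum.Crystallization.Theorems.ChartedZeroExcessLayeredLatticeLiouville

/-! ### YD.1  Strength audit of [CC]: the hidden pointwise clause -/

/-- in a `δ`-separated set the trace of a ball of radius `≤ δ` about a site is the site alone. [this file, g44] -/
theorem inter_ball_eq_singleton_of_isSep {δ : ℝ} {S : Set E3} (hsep : IsSep δ S) {x : E3} (hx : x ∈ S) {ρ : ℝ} (hρ : 0 < ρ)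
    (hρδ : ρ ≤ δ) : S ∩ ball x ρ = {x} := by
  ext p
  simp only [mem_inter_iff, mem_ball, mem_singleton_iff]
  constructor
  · rintro ⟨hp, hpx⟩
    by_contra hne
    have h := hsep p hp x hx hne
    linarith
  · rintro rfl
    exact ⟨hx, by rw [dist_self]; exact hρ⟩

/-- the finite average over a singleton is the value. [this file, g44] -/
theorem finavg_singleton (x : E3) (h : E3 → ℝ) : finavg ({x} : Set E3) h = h x := by
  unfold finavg
  rw [finsum_mem_singleton, Set.ncard_singleton, Nat.cast_one, div_one]

/-- ★ **AUDIT (PROVED): the (ii♭)-clause of [CC] at a site `x` of a `δ`-separated `S` inside the open window forces `σ x² ≤ c₁·A·η`** — test it at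
`r := δ/2` (all three balls are `{x}`) and the rigid motion `(1, Ψ' x − x)` (deviation `0 ≤ κ r²`).  Hence [CC] as typed contains POINTWISE
`√η`-flatness of the strain of its re-registration on `S ∩ ball 0 (8R)`; [CC°] below drops exactly this. [this file, g44] -/
theorem sq_le_floor_of_caccioppoli_clause {δ : ℝ} (hδ : 0 < δ) {S : Set E3} (hsep : IsSep δ S) {Ψ' : E3 → E3} {σ : E3 → ℝ}
    {κ c₁ A η R : ℝ} (hκ : 0 ≤ κ) {x : E3} (hx : x ∈ S) (hxR : x ∈ ball (0 : E3) (8 * R))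
    (hii : ∀ r : ℝ, 0 < r → S ∩ ball x (2 * r) ⊆ ball 0 (8 * R) →
      ∀ (U : E3 ≃ₗᵢ[ℝ] E3) (v : E3), LinearMap.det (U.toLinearEquiv : E3 →ₗ[ℝ] E3) = 1 →
        finavg (S ∩ ball x (3 / 2 * r)) (fun p => ‖Ψ' p - (U p + v)‖ ^ 2) ≤ κ * r ^ 2 →
          finavg (S ∩ ball x r) (fun y => σ y ^ 2) ≤
            c₁ * (finavg (S ∩ ball x (3 / 2 * r)) (fun p => ‖Ψ' p - (U p + v)‖ ^ 2) / r ^ 2 + A * η)) :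
    σ x ^ 2 ≤ c₁ * (A * η) := by
  have hr : (0 : ℝ) < δ / 2 := by positivity
  have h2 : S ∩ ball x (2 * (δ / 2)) = {x} := inter_ball_eq_singleton_of_isSep hsep hx (by positivity) (by linarith)
  have h32 : S ∩ ball x (3 / 2 * (δ / 2)) = {x} := inter_ball_eq_singleton_of_isSep hsep hx (by positivity) (by linarith)
  have h1 : S ∩ ball x (δ / 2) = {x} := inter_ball_eq_singleton_of_isSep hsep hx hr (by linarith)
  have hsub : S ∩ ball x (2 * (δ / 2)) ⊆ ball 0 (8 * R) := by
    rw [h2]; exact singleton_subset_iff.2 hxR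
  have hdev : finavg (S ∩ ball x (3 / 2 * (δ / 2)))
      (fun p => ‖Ψ' p - ((LinearIsometryEquiv.refl ℝ E3) p + (Ψ' x - x))‖ ^ 2) = 0 := by
    rw [h32, finavg_singleton]; simp
  have h := hii (δ / 2) hr hsub (LinearIsometryEquiv.refl ℝ E3) (Ψ' x - x) det_refl_E3_eq_one
    (by rw [hdev]; positivity)
  rw [hdev, h1, finavg_singleton, zero_div, zero_add] at h
  exact h

/-! ### YD.2  [CC°]: the residual with a radius floor, and the line re-seamed from it -/

/-- ★★ **[CC°] «TameGscCaccioppoliFloorPG ϑ aHi Λ θ s» — [CC] WITH A RADIUS FLOOR** (the new residual of the mechanism line): verbatim [CC]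
`TameGscCaccioppoliPG ϑ` (part UC) with one more constant `∃ r₀ > 0` (after `A`, before `K₀`: uniform in `η` and `R`) and the hypothesis `r₀ ≤ r`
in (ii♭).  WEAKER than [CC] (`tameGscCaccioppoliFloorPG_of_tameGscCaccioppoliPG`, PROVED), strictly at currency level ([CC] forces `σ x² ≤ c₁·A·η`
at every site of the open window, `sq_le_floor_of_caccioppoli_clause`; [CC°] bounds `σ²` only in mean on balls of radius `≥ r₀`); SUFFICIENT for the
line (`tameRigidCaccioppoliPG_of_gscCaccioppoliFloor_of_kornSobolev`, PROVED).  MECHANISM · GSC-priced · UNDECIDED(stated test: census instrument (F2)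
«CaccioppoliRatioScan» — on relaxed windows, per atom-centred ball `B(x,r)`, `r₀ ≤ r`, `B(x,2r)` inside the window, with `(U,v)` the Kabsch fit of the
registered positions on `B(x,3r/2)` and `σ` the rigid star misfit: the ratio `⨍_{B_r} σ² / (⨍_{B_{3r/2}} ‖Ψ' − rigid‖²/r² + A·η̂)` stays bounded across
balls and windows; kill sign: growth in `r` or in `1/η̂`) · INSTRUMENTABLE.  Its perturbative basin and complement are separated below ([CC°_W], [W]).
Why it might fail: as [CC] minus its pointwise clause — the hole-filling iteration's last `O(1)`-width step must come from single-site force balance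
tested against the cut-off displacement, which linearises only where strain is POINTWISE small and the rotation field POINTWISE slowly varying on
`B(x,3r/2)`: granted in mean square by the `κ`-near restriction, not pointwise (a cool-but-wound core or a warm star inside a near-rigid ball) —
exactly the complement [W] must exclude; and Chebyshev-bad collar atoms are priced `|e⋆|` each.
Sources: as [CC] — Giaquinta–Modica, J. reine angew. Math. 311/312 (1979) 145; [giaquinta1984 Ch. V Lemma 3.1, Ch. IX]; Giusti in [hildebrandt1988
pp. 85–86]; Evans, Arch. Ration. Mech. Anal. 95 (1986) 227; E–Ming, Arch. Ration. Mech. Anal. 183 (2007) 241; this tree: parts UC ([CC]), UA ([C]),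
TC ((C♭)), `UniformTameStability` (part TP). [this file, g44] -/
def TameGscCaccioppoliFloorPG (ϑ aHi Λ θ s : ℝ) : Prop :=
  ∀ δ : ℝ, 0 < δ → ∀ a : ℝ, 0 < a → ∀ Cg : ℝ, 1 ≤ Cg → ∃ Cg' : ℝ, Cg ≤ Cg' ∧
    ∃ c₁ : ℝ, 0 < c₁ ∧ ∃ κ : ℝ, 0 < κ ∧ ∃ A : ℝ, 0 ≤ A ∧ ∃ r₀ : ℝ, 0 < r₀ ∧
    ∀ K₀ : ℝ, 0 < K₀ → ∃ η₁ : ℝ, 0 < η₁ ∧ ∃ R₁ : ℝ, 0 < R₁ ∧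
      ∀ S : Set E3, IsDoorSetPG aHi δ S → (∀ q ∈ S, IsTwoShellAffineGood θ S q) →
        ∀ η : ℝ, 0 < η → η ≤ η₁ → ∀ R : ℝ, R₁ ≤ R →
          ∀ (L : E3 ≃L[ℝ] E3) (w : ℤ → E3), IsEquilChart a s Λ L w →
            ∀ Ψ : E3 → E3, IsGlobalReg Cg η R S (LayeredHom (L : E3 →L[ℝ] E3) w) Ψ →
              K₀ ≤ η * nK (atomsIn (μS S) 0 R) →
                IsTameOn ϑ S (LayeredHom (L : E3 →L[ℝ] E3) w) (atomsIn (μS S) 0 (9 * R)) →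
                ∃ Ψ' : E3 → E3, IsGlobalReg Cg' η R S (LayeredHom (L : E3 →L[ℝ] E3) w) Ψ' ∧
                  ∃ (Q : E3 → (E3 ≃ₗᵢ[ℝ] E3)) (σ : E3 → ℝ), IsTiltStrainData S (8 * R) Ψ' Q σ ∧ (∀ x, σ x ≤ 12) ∧
                    (∑ᶠ x ∈ atomsIn (μS S) 0 (8 * R), σ x ^ 2) ≤ A * η * nK (atomsIn (μS S) 0 (8 * R)) ∧
                    ∀ x ∈ S, ∀ r : ℝ, 0 < r → r₀ ≤ r → S ∩ ball x (2 * r) ⊆ ball 0 (8 * R) →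
                      ∀ (U : E3 ≃ₗᵢ[ℝ] E3) (v : E3), LinearMap.det (U.toLinearEquiv : E3 →ₗ[ℝ] E3) = 1 →
                        finavg (S ∩ ball x (3 / 2 * r)) (fun p => ‖Ψ' p - (U p + v)‖ ^ 2) ≤ κ * r ^ 2 →
                          finavg (S ∩ ball x r) (fun y => σ y ^ 2) ≤
                            c₁ * (finavg (S ∩ ball x (3 / 2 * r)) (fun p => ‖Ψ' p - (U p + v)‖ ^ 2) / r ^ 2 + A * η)

/-- **[CC] ⇒ [CC°] (PROVED)** — the floored residual is WEAKER than [CC] (`r₀ := 1`, the floor hypothesis unused). [this file, g44] -/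
theorem tameGscCaccioppoliFloorPG_of_tameGscCaccioppoliPG {ϑ aHi Λ θ s : ℝ} (h : TameGscCaccioppoliPG ϑ aHi Λ θ s) :
    TameGscCaccioppoliFloorPG ϑ aHi Λ θ s := by
  intro δ hδ a ha Cg hCg
  obtain ⟨Cg', hCg', c₁, hc₁, κ, hκ, A, hA, hK⟩ := h δ hδ a ha Cg hCg
  refine ⟨Cg', hCg', c₁, hc₁, κ, hκ, A, hA, 1, one_pos, fun K₀ hK₀ => ?_⟩
  obtain ⟨η₁, hη₁, R₁, hR₁, h1⟩ := hK K₀ hK₀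
  refine ⟨η₁, hη₁, R₁, hR₁, fun S hS hgood η hη hηle R hR L w hLw Ψ hΨ hfat htame => ?_⟩
  obtain ⟨Ψ', hΨ', Q, σ, hd, h12, hL2, hii⟩ := h1 S hS hgood η hη hηle R hR L w hLw Ψ hΨ hfat htame
  exact ⟨Ψ', hΨ', Q, σ, hd, h12, hL2, fun x hx r hr _ hsub U v hU hnear => hii x hx r hr hsub U v hU hnear⟩

/-- ★★★ **SEAM (PROVED): `[KS] ∧ [CC°] ⇒ [C_T]`** — part UC's seam with a SMALL-BALL branch.  LARGE balls `r ≥ r₀`: [KS] at `ρ := 3r/2` gives the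
rigid motion; NEAR (`⨍ ≤ κ r²`) ⇒ (ii♭), FAR ⇒ the `d`-mean on `B(x,2r)` exceeds `4κ/(9 C_KS)` against `σ ≤ 12` (as in part UC).  SMALL balls
`r < r₀`: `⨍_{B_r} σ² ≤ m := max_{B_{2r}} σ²` and `m^d ≤ #(S ∩ B_{2r})·⨍_{B_{2r}} (σ²)^d ≤ N₀·⨍_{B_{2r}} (σ²)^d` (one term of the sum; packing
`#(S ∩ B(x,2r)) ≤ N₀ := (2·(2r₀)/δ + 1)³`), so `⨍_{B_r} σ² ≤ N₀^{1/d}·(⨍_{B_{2r}} (σ²)^d)^{1/d}`.  Constant `b := (9/4)·c₁·C_KS + 324·C_KS/κ + N₀^{1/d}`,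
exponent [KS]'s `d`. [this file, g44] -/
theorem tameRigidCaccioppoliPG_of_gscCaccioppoliFloor_of_kornSobolev {ϑ aHi Λ θ s : ℝ} (hKS : KornSobolevPoincareP aHi θ)
    (hCC : TameGscCaccioppoliFloorPG ϑ aHi Λ θ s) : TameRigidCaccioppoliPG ϑ aHi Λ θ s := by
  intro δ hδ a ha Cg hCg
  obtain ⟨CKS, hCKS, d, hd0, hd1, hks⟩ := hKS δ hδ
  obtain ⟨Cg', hCg', c₁, hc₁, κ, hκ, A, hA, r₀, hr₀, hK⟩ := hCC δ hδ a ha Cg hCg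
  have hCKS0 : 0 < CKS := by linarith
  set N₀ : ℝ := (2 * (2 * r₀) / δ + 1) ^ 3 with hN₀def
  have hN₀0 : 0 ≤ N₀ := by positivity
  have hb3 : (0 : ℝ) ≤ N₀ ^ (1 / d) := Real.rpow_nonneg hN₀0 _
  refine ⟨Cg', hCg', 9 / 4 * c₁ * CKS + 324 * CKS / κ + N₀ ^ (1 / d), by positivity, d, hd0, hd1, A, hA, fun K₀ hK₀ => ?_⟩
  obtain ⟨η₁, hη₁, R₁, hR₁, hmain⟩ := hK K₀ hK₀
  refine ⟨η₁, hη₁, R₁, hR₁, ?_⟩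
  intro S hS hgood η hη hηle R hR L w hLw Ψ hΨ hfat htame
  obtain ⟨Ψ', hΨ', Q, σ, hd, h12, hL2, hii⟩ := hmain S hS hgood η hη hηle R hR L w hLw Ψ hΨ hfat htame
  refine ⟨Ψ', hΨ', Q, σ, hd, hL2, ?_⟩
  intro x hx r hr hsub
  set F : ℝ := finavg (S ∩ ball x (2 * r)) (fun y => (σ y ^ 2) ^ d)
  have hF0 : 0 ≤ F := finavg_nonneg_of_nonneg fun y => Real.rpow_nonneg (sq_nonneg (σ y)) d
  set M : ℝ := F ^ (1 / d)
  have hM0 : 0 ≤ M := Real.rpow_nonneg hF0 _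
  have hAη : 0 ≤ A * η := mul_nonneg hA hη.le
  have hr2 : (0 : ℝ) < r ^ 2 := by positivity
  have hb1 : (0 : ℝ) ≤ 9 / 4 * c₁ * CKS := by positivity
  have hb2 : (0 : ℝ) ≤ 324 * CKS / κ := by positivity
  -- every branch bounds the left side by ONE of the three summands of `b` times `(M + A·η)`
  have hB : ∀ {t c : ℝ}, c ≤ 9 / 4 * c₁ * CKS + 324 * CKS / κ + N₀ ^ (1 / d) → t ≤ c * (M + A * η) →
      t ≤ (9 / 4 * c₁ * CKS + 324 * CKS / κ + N₀ ^ (1 / d)) * (M + A * η) :=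
    fun hc ht => ht.trans (mul_le_mul_of_nonneg_right hc (add_nonneg hM0 hAη))
  by_cases hsmall : r < r₀
  · -- SMALL balls: maximum over `B(x, 2r)` and packing
    have hsep : IsSep δ S := hS.isDoorSetP.2.1
    have hfin2 : (S ∩ ball x (2 * r)).Finite := finite_inter_ball_of_isSep hδ hsep x (2 * r)
    have hne2 : (S ∩ ball x (2 * r)).Nonempty := ⟨x, hx, mem_ball_self (by positivity)⟩
    obtain ⟨y, hy, hymax⟩ := (S ∩ ball x (2 * r)).exists_max_image (fun z => σ z ^ 2) hfin2 hne2
    have hm0 : 0 ≤ σ y ^ 2 := sq_nonneg _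
    have h1 : finavg (S ∩ ball x r) (fun z => σ z ^ 2) ≤ σ y ^ 2 :=
      finavg_le_of_le hm0 fun z hz => hymax z ⟨hz.1, ball_subset_ball (by linarith) hz.2⟩
    have hcard : ((S ∩ ball x (2 * r)).ncard : ℝ) ≤ N₀ :=
      (ncard_inter_ball_le_packing hδ hsep x (by positivity : (0 : ℝ) ≤ 2 * r)).trans (by rw [hN₀def]; gcongr)
    have hsum : (σ y ^ 2) ^ d ≤ ∑ᶠ z ∈ S ∩ ball x (2 * r), (σ z ^ 2) ^ d := by
      rw [finsum_mem_eq_finite_toFinset_sum _ hfin2]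
      exact Finset.single_le_sum (f := fun z => (σ z ^ 2) ^ d) (fun z _ => Real.rpow_nonneg (sq_nonneg (σ z)) d)
        (hfin2.mem_toFinset.2 hy)
    rw [finsum_mem_eq_ncard_mul_finavg hfin2 hne2] at hsum
    have hmd : (σ y ^ 2) ^ d ≤ N₀ * F := hsum.trans (mul_le_mul_of_nonneg_right hcard hF0)
    have h2 : ((σ y ^ 2) ^ d) ^ (1 / d) ≤ (N₀ * F) ^ (1 / d) := Real.rpow_le_rpow (Real.rpow_nonneg hm0 d) hmd (by positivity)
    rw [← Real.rpow_mul hm0, mul_one_div_cancel hd0.ne', Real.rpow_one, Real.mul_rpow hN₀0 hF0] at h2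
    refine hB (c := N₀ ^ (1 / d)) (by linarith) ?_
    calc finavg (S ∩ ball x r) (fun z => σ z ^ 2) ≤ σ y ^ 2 := h1
      _ ≤ N₀ ^ (1 / d) * M := h2
      _ ≤ N₀ ^ (1 / d) * (M + A * η) := mul_le_mul_of_nonneg_left (le_add_of_nonneg_right hAη) hb3
  · -- LARGE balls `r₀ ≤ r`: part UC's argument
    have hr₀r : r₀ ≤ r := not_lt.mp hsmall
    have hρ : (0 : ℝ) < 3 / 2 * r := by positivity
    have hball : ball x (4 / 3 * (3 / 2 * r)) = ball x (2 * r) := by congr 1; ring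
    have hsub' : S ∩ ball x (4 / 3 * (3 / 2 * r)) ⊆ ball 0 (8 * R) := by rw [hball]; exact hsub
    obtain ⟨U, v, hU, hks'⟩ := hks S hS.isDoorSetP hgood (8 * R) Ψ' Q σ hd x hx (3 / 2 * r) hρ hsub'
    rw [hball] at hks'
    by_cases hnear : finavg (S ∩ ball x (3 / 2 * r)) (fun p => ‖Ψ' p - (U p + v)‖ ^ 2) ≤ κ * r ^ 2
    · -- NEAR-rigid case: (ii♭) at `(U, v)`
      have h1 := hii x hx r hr hr₀r hsub U v hU hnear
      have hdiv : finavg (S ∩ ball x (3 / 2 * r)) (fun p => ‖Ψ' p - (U p + v)‖ ^ 2) / r ^ 2 ≤ CKS * (3 / 2 * r) ^ 2 * M / r ^ 2 :=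
        div_le_div_of_nonneg_right hks' hr2.le
      have hc₁b : c₁ * (A * η) ≤ 9 / 4 * c₁ * CKS * (A * η) := by
        refine mul_le_mul_of_nonneg_right ?_ hAη
        have := mul_le_mul_of_nonneg_left (show (1 : ℝ) ≤ 9 / 4 * CKS by linarith) hc₁.le
        linarith
      refine hB (c := 9 / 4 * c₁ * CKS) (by linarith) ?_
      calc finavg (S ∩ ball x r) (fun y => σ y ^ 2)
          ≤ c₁ * (finavg (S ∩ ball x (3 / 2 * r)) (fun p => ‖Ψ' p - (U p + v)‖ ^ 2) / r ^ 2 + A * η) := h1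
        _ ≤ c₁ * (CKS * (3 / 2 * r) ^ 2 * M / r ^ 2 + A * η) := mul_le_mul_of_nonneg_left (add_le_add hdiv le_rfl) hc₁.le
        _ = 9 / 4 * c₁ * CKS * M + c₁ * (A * η) := by
            field_simp
            ring
        _ ≤ 9 / 4 * c₁ * CKS * (M + A * η) := by linarith
    · -- FAR case: rigidity lower bound on `M` against `σ ≤ 12`
      have hfar : κ * r ^ 2 < 9 / 4 * CKS * M * r ^ 2 := by
        have hexp : CKS * (3 / 2 * r) ^ 2 * M = 9 / 4 * CKS * M * r ^ 2 := by ring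
        rw [← hexp]; exact lt_of_lt_of_le (not_le.mp hnear) hks'
      have hκM : κ < 9 / 4 * CKS * M := lt_of_mul_lt_mul_right hfar hr2.le
      have h144 : finavg (S ∩ ball x r) (fun y => σ y ^ 2) ≤ 144 := by
        refine finavg_le_of_le (by norm_num) fun y _ => ?_
        calc σ y ^ 2 ≤ 12 ^ 2 := pow_le_pow_left₀ (hd.2.1 y) (h12 y) 2
          _ = 144 := by norm_num
      refine hB (c := 324 * CKS / κ) (by linarith) ?_
      calc finavg (S ∩ ball x r) (fun y => σ y ^ 2) ≤ 144 := h144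
        _ ≤ 324 * CKS / κ * M := by
            rw [div_mul_eq_mul_div, le_div_iff₀ hκ]
            linarith
        _ ≤ 324 * CKS / κ * (M + A * η) := mul_le_mul_of_nonneg_left (le_add_of_nonneg_right hAη) hb2

/-! ### YD.3  Coherence of a star (the SPECIAL-class criterion one amplitude level down: cool AND co-rotated with the chart) -/

/-- ★ **`IsCoherentStar ϑ₁ ω₁ S H x` — the `4`-star of `S` at `x` is `(ϑ₁, ω₁)`-COHERENT relative to the model set `H`**: `ϑ₁`-tame (`IsTameStar`,
part UC) with a fitting rotation `U` whose `tilt` — operator distance to the identity, i.e. to the ORIENTATION OF THE CHART — is `≤ ω₁`.  COOL and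
CO-ROTATED; intrinsic given `H`, registration-free.  Content in SMALL `(ϑ₁, ω₁)`: every star is `(12, 0)`-coherent under a tear-free registration
(`isCoherentStar_twelve_zero_of_globalReg`); small tilt–strain data witness coherence (`isCoherentStar_of_tiltStrainData`). [this file, g44] -/
def IsCoherentStar (ϑ₁ ω₁ : ℝ) (S H : Set E3) (x : E3) : Prop :=
  ∃ (U : E3 ≃ₗᵢ[ℝ] E3) (g : E3 → E3), LinearMap.det (U.toLinearEquiv : E3 →ₗ[ℝ] E3) = 1 ∧ tilt U ≤ ω₁ ∧
    MapsTo g (S ∩ closedBall x 4) H ∧ ∀ p ∈ S, dist p x ≤ 4 → dist (U (p - x)) (g p - g x) ≤ ϑ₁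

/-- **`IsCoherentOn ϑ₁ ω₁ S H K`** — every site of `K` has a `(ϑ₁, ω₁)`-coherent star: the patch `K` lies in the PERTURBATIVE BASIN. [this file, g44] -/
def IsCoherentOn (ϑ₁ ω₁ : ℝ) (S H K : Set E3) : Prop := ∀ x ∈ K, IsCoherentStar ϑ₁ ω₁ S H x

/-- coherence of a set is monotone in both thresholds and antitone in the set. [this file, g44] -/
theorem IsCoherentOn.mono {ϑ₁ ϑ₁' ω₁ ω₁' : ℝ} (hϑ : ϑ₁ ≤ ϑ₁') (hω : ω₁ ≤ ω₁') {S H K K' : Set E3} (hK : K' ⊆ K)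
    (h : IsCoherentOn ϑ₁ ω₁ S H K) : IsCoherentOn ϑ₁' ω₁' S H K' := fun x hx => by
  obtain ⟨U, g, hU, ht, hg, hb⟩ := h x (hK hx)
  exact ⟨U, g, hU, ht.trans hω, hg, fun p hp hpx => (hb p hp hpx).trans hϑ⟩

/-- a coherent patch is tame at the same strain threshold (forget the tilt bound). [this file, g44] -/
theorem IsCoherentOn.isTameOn {ϑ₁ ω₁ : ℝ} {S H K : Set E3} (h : IsCoherentOn ϑ₁ ω₁ S H K) : IsTameOn ϑ₁ S H K := fun x hx => by
  obtain ⟨U, g, hU, _, hg, hb⟩ := h x hx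
  exact ⟨U, g, hU, hg, hb⟩

/-- the identity has tilt `0`. [this file, g44] -/
theorem tilt_refl : tilt (LinearIsometryEquiv.refl ℝ E3) = 0 := by
  unfold tilt
  have h : ((LinearIsometryEquiv.refl ℝ E3).toContinuousLinearEquiv : E3 →L[ℝ] E3) - ContinuousLinearMap.id ℝ E3 = 0 := by
    ext v
    simp
  rw [h, norm_zero]

/-- DICTIONARY: tilt–strain data `(Q, σ)` of a map `Ψ : S → H` on `win R` with `σ x ≤ ϑ₁` and `tilt (Q x) ≤ ω₁` witness the coherence of the star at
`x ∈ win R` (`U := Q x`, `g := Ψ`). [this file, g44] -/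
theorem isCoherentStar_of_tiltStrainData {S H : Set E3} {R : ℝ} {Ψ : E3 → E3} {Q : E3 → (E3 ≃ₗᵢ[ℝ] E3)} {σ : E3 → ℝ}
    (hd : IsTiltStrainData S R Ψ Q σ) (hΨ : MapsTo Ψ S H) {x : E3} (hx : x ∈ atomsIn (μS S) 0 R) {ϑ₁ ω₁ : ℝ} (hσ : σ x ≤ ϑ₁)
    (hQ : tilt (Q x) ≤ ω₁) : IsCoherentStar ϑ₁ ω₁ S H x :=
  ⟨Q x, Ψ, hd.1 x, hQ, fun _ hp => hΨ hp.1, fun p hp hpx => (hd.2.2 x hx p hp hpx).trans hσ⟩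

/-- VACUITY GUARD: under any globally registered `Ψ` every star of `S` is `(12, 0)`-coherent (`U := 1`, `g := Ψ`; tear-free `4 ↦ 8`) — the content
of coherence is in small `(ϑ₁, ω₁)`. [this file, g44] -/
theorem isCoherentStar_twelve_zero_of_globalReg {Cg η R : ℝ} {S H : Set E3} {Ψ : E3 → E3} (hΨ : IsGlobalReg Cg η R S H Ψ) {x : E3}
    (hx : x ∈ S) : IsCoherentStar 12 0 S H x :=
  ⟨LinearIsometryEquiv.refl ℝ E3, Ψ, det_refl_E3_eq_one, tilt_refl.le, fun _ hp => hΨ.1.mapsTo hp.1,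
    fun _ hp hpx => dist_rot_bond_le_twelve hΨ.2.1 _ hx hp hpx⟩

/-! ### YD.4  The dichotomy beneath [CC°]: [W] (no warm star, no wound region) and [CC°_W] ([CC°] in the perturbative basin) -/

/-- ★★ **[W] «CoherentWindowPG ϑ aHi Λ θ s» — TAME NEAR-FLAT FAT GSC DOOR WINDOWS ARE COHERENT AT EVERY TOLERANCE** (the GENERIC side excluded
outright).  [T]'s binders (part UC) preceded by `∀ ϑ₁ > 0, ∀ ω₁ > 0`, with the tameness of `win 9R` as hypothesis: once `η ≤ η₁(ϑ₁, ω₁, …)`, `R ≥ R₁`,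
EVERY site of `win 9R` has a `(ϑ₁, ω₁)`-coherent star relative to the chart lattice — no WARM star (misfit in `(ϑ₁, ϑ]`), no WOUND region (fitting
rotation tilted `> ω₁` from the chart).  «Below the hot threshold there is no intermediate local state: local amplitudes are slaved to the background.»
Qualitative (no rate), pointwise, intrinsic given the chart.  NEW · GSC-priced (door `IsDoorSetPG`) · UNDECIDED(stated test: census instrument (F1)
«CoherenceScan» on the relaxed interior windows of TAG 174 (a⁗) and on the generated configurations of (F0b): per window the registration level
`η̂ := ⨍ τ²`, the maximal Kabsch star misfit `m_max` and the maximal Kabsch rotation angle to the fitted chart `t_max`; prediction `m_max, t_max → 0` along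
`η̂ → 0`, indeed `m_max²/η̂`, `t_max²/η̂` bounded; kill sign: tame windows passing the GSC proxy with `m_max` or `t_max` bounded below while `η̂ → 0`) ·
INSTRUMENTABLE · IDEA-NAMED (COOL half: compactness along `η → 0` — a persistent warm star survives in a local limit, an entire `ϑ`-tame single-site-Nash
e⋆-GSC door configuration, so it follows from the deterministic TAME LIOUVILLE statement «entire `ϑ`-tame e⋆-GSC door configurations are rigid layered
lattices» (perturbative: `ϑ = 1/20` inside the Cauchy–Born range of the chart, `UniformTameStability`); CO-ROTATED half: NOT kinematic — uniformly small
strain allows logarithmic winding (`L^∞`-Korn fails: Ornstein; F. John's BMO estimate), so slow winding must be excluded energetically: an e⋆-GSC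
comparison unwinding a wound core at elastic-energy gain, or interior `L^∞` decay for the linearised lattice system with the registration as far field).
Why it might fail: a tame, warm, self-equilibrated local state (a force-dipole cluster of amplitude between `ϑ₁` and `1/20`) or a slowly wound tame
region that no finite e⋆-replacement improves — none known for Lennard-Jones fcc/hcp nor seen in the census, but no theorem excludes them; and the cool
half leans on a tame Liouville statement that is itself open.
Sources: F. John, Comm. Pure Appl. Math. 14 (1961) 391; Friesecke–James–Müller, Comm. Pure Appl. Math. 55 (2002) 1461, Thm 3.1; Conti–Dolzmann–Müller,
arXiv 1210.2092; Ehrlacher–Ortner–Shapeev, Arch. Ration. Mech. Anal. 222 (2016) 1217; Theil, Comm. Math. Phys. 262 (2006) 209; E–Ming, Arch. Ration.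
Mech. Anal. 183 (2007) 241; this tree: [T] `TameWindowPG` (part UC), `TiltRigidityP` (part TR), `UniformTameStability` (part TP); census TAG 174 (a⁗).
[this file, g44] -/
def CoherentWindowPG (ϑ aHi Λ θ s : ℝ) : Prop :=
  ∀ ϑ₁ : ℝ, 0 < ϑ₁ → ∀ ω₁ : ℝ, 0 < ω₁ →
  ∀ δ : ℝ, 0 < δ → ∀ a : ℝ, 0 < a → ∀ Cg : ℝ, 1 ≤ Cg → ∀ K₀ : ℝ, 0 < K₀ → ∃ η₁ : ℝ, 0 < η₁ ∧ ∃ R₁ : ℝ, 0 < R₁ ∧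
    ∀ S : Set E3, IsDoorSetPG aHi δ S → (∀ q ∈ S, IsTwoShellAffineGood θ S q) →
      ∀ η : ℝ, 0 < η → η ≤ η₁ → ∀ R : ℝ, R₁ ≤ R →
        ∀ (L : E3 ≃L[ℝ] E3) (w : ℤ → E3), IsEquilChart a s Λ L w →
          ∀ Ψ : E3 → E3, IsGlobalReg Cg η R S (LayeredHom (L : E3 →L[ℝ] E3) w) Ψ →
            K₀ ≤ η * nK (atomsIn (μS S) 0 R) →
              IsTameOn ϑ S (LayeredHom (L : E3 →L[ℝ] E3) w) (atomsIn (μS S) 0 (9 * R)) →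
              IsCoherentOn ϑ₁ ω₁ S (LayeredHom (L : E3 →L[ℝ] E3) w) (atomsIn (μS S) 0 (9 * R))

/-- ★★ **[CC°_W] «CoherentGscCaccioppoliPG ϑ aHi Λ θ s» — [CC°] IN THE PERTURBATIVE BASIN** (the SPECIAL side): verbatim [CC°] with two more
constants `∃ ϑ₁ > 0, ∃ ω₁ > 0` OF THE PROVER'S CHOICE (after `r₀`) and the hypothesis `IsCoherentOn ϑ₁ ω₁ S (LayeredHom L w) (win 9R)` after tameness.
WEAKER than [CC°] (`coherentGscCaccioppoliPG_of_tameGscCaccioppoliFloorPG`, PROVED); with [W] it gives [CC°] back (`tameGscCaccioppoliFloorPG_of_coherent`,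
PROVED) — NO constant is matched across the seam (existential here, universal in [W]).  MECHANISM-KNOWN-type · GSC-priced by binder but driven by
single-site force balance · UNDECIDED · ATTACKABLE·L: on a coherent window the registration to the chart is locally FORCED (nearest chart site after
undoing a tilt `≤ ω₁`), the displacement `w := Ψ' − (U· + v)` has POINTWISE small discrete gradient (`≲ ϑ₁ + ω₁ + √κ` on `κ`-near balls of radius
`≥ r₀`), site forces expand about the force-free equilibrium chart with remainder `≤ C(ϑ₁ + ω₁)·|∇w|²` per site, and testing exact force balance (Nash =
Euler–Lagrange) against `ζ²w` gives `Σ ζ²⟨∇w, D²E_chart ∇w⟩ ≤ C·r⁻²·Σ_{B_{3r/2}} |w|² + C(ϑ₁ + ω₁)·Σ ζ²|∇w|² + floor`; phonon/Cauchy–Born stability of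
the chart (`UniformTameStability`) and Korn on the compactly supported `ζw` make the left side `≥ c·Σ_{B_r} |∇w|² ≥ c'·Σ_{B_r} σ²` (`Q x := U`), and the
cubic remainder is absorbed once `ϑ₁ + ω₁ ≤ c/(2C)` — the prover picks the basin.  No hole filling, no competitor, no deleted atoms.  Census
instrument: (F2) restricted to coherent windows.
Why it might fail: only through the typing — (a) the floor `A·η` must absorb the chart's residual self-stress if `IsEquilChart` leaves one (a
pre-stressed reference adds a LINEAR null-Lagrangian flux `Σ⟨T₀, ∇(ζ²w)⟩`, fine against `A·η` only after Cauchy–Schwarz with the `κ`-near budget);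
(b) `Ψ'` must be locally exact on coherent windows (a gratuitous relabelling inside a star makes `σ = O(1)` there) — the prover chooses `Ψ'`;
(c) `r₀` must exceed the cut-off collar width (`r₀ ≥ 16`).
Sources: [giaquinta1984 Ch. III §1 (Caccioppoli for linear systems: Gårding + cut-off)]; Ehrlacher–Ortner–Shapeev, Arch. Ration. Mech. Anal. 222 (2016)
1217, §§2–3; E–Ming, Arch. Ration. Mech. Anal. 183 (2007) 241; Hudson–Ortner, arXiv 1304.5976; Braun–Schmidt, arXiv 1604.01787; this tree:
`UniformTameStability` (part TP), (C) `CaccioppoliPGL` (part Q), [KS] (part UC). [this file, g44] -/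
def CoherentGscCaccioppoliPG (ϑ aHi Λ θ s : ℝ) : Prop :=
  ∀ δ : ℝ, 0 < δ → ∀ a : ℝ, 0 < a → ∀ Cg : ℝ, 1 ≤ Cg → ∃ Cg' : ℝ, Cg ≤ Cg' ∧
    ∃ c₁ : ℝ, 0 < c₁ ∧ ∃ κ : ℝ, 0 < κ ∧ ∃ A : ℝ, 0 ≤ A ∧ ∃ r₀ : ℝ, 0 < r₀ ∧ ∃ ϑ₁ : ℝ, 0 < ϑ₁ ∧ ∃ ω₁ : ℝ, 0 < ω₁ ∧
    ∀ K₀ : ℝ, 0 < K₀ → ∃ η₁ : ℝ, 0 < η₁ ∧ ∃ R₁ : ℝ, 0 < R₁ ∧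
      ∀ S : Set E3, IsDoorSetPG aHi δ S → (∀ q ∈ S, IsTwoShellAffineGood θ S q) →
        ∀ η : ℝ, 0 < η → η ≤ η₁ → ∀ R : ℝ, R₁ ≤ R →
          ∀ (L : E3 ≃L[ℝ] E3) (w : ℤ → E3), IsEquilChart a s Λ L w →
            ∀ Ψ : E3 → E3, IsGlobalReg Cg η R S (LayeredHom (L : E3 →L[ℝ] E3) w) Ψ →
              K₀ ≤ η * nK (atomsIn (μS S) 0 R) →
                IsTameOn ϑ S (LayeredHom (L : E3 →L[ℝ] E3) w) (atomsIn (μS S) 0 (9 * R)) →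
                IsCoherentOn ϑ₁ ω₁ S (LayeredHom (L : E3 →L[ℝ] E3) w) (atomsIn (μS S) 0 (9 * R)) →
                ∃ Ψ' : E3 → E3, IsGlobalReg Cg' η R S (LayeredHom (L : E3 →L[ℝ] E3) w) Ψ' ∧
                  ∃ (Q : E3 → (E3 ≃ₗᵢ[ℝ] E3)) (σ : E3 → ℝ), IsTiltStrainData S (8 * R) Ψ' Q σ ∧ (∀ x, σ x ≤ 12) ∧
                    (∑ᶠ x ∈ atomsIn (μS S) 0 (8 * R), σ x ^ 2) ≤ A * η * nK (atomsIn (μS S) 0 (8 * R)) ∧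
                    ∀ x ∈ S, ∀ r : ℝ, 0 < r → r₀ ≤ r → S ∩ ball x (2 * r) ⊆ ball 0 (8 * R) →
                      ∀ (U : E3 ≃ₗᵢ[ℝ] E3) (v : E3), LinearMap.det (U.toLinearEquiv : E3 →ₗ[ℝ] E3) = 1 →
                        finavg (S ∩ ball x (3 / 2 * r)) (fun p => ‖Ψ' p - (U p + v)‖ ^ 2) ≤ κ * r ^ 2 →
                          finavg (S ∩ ball x r) (fun y => σ y ^ 2) ≤
                            c₁ * (finavg (S ∩ ball x (3 / 2 * r)) (fun p => ‖Ψ' p - (U p + v)‖ ^ 2) / r ^ 2 + A * η)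

/-- ★★★ **SEAM (PROVED): `[W] ∧ [CC°_W] ⇒ [CC°]`** — the dichotomy is exhaustive below the hot threshold: a tame fat near-flat window is
`(ϑ₁, ω₁)`-coherent by [W] at the basin [CC°_W] chose, then [CC°_W] applies; thresholds `η₁ := min`, `R₁ := max`, constants those of [CC°_W].
[this file, g44] -/
theorem tameGscCaccioppoliFloorPG_of_coherent {ϑ aHi Λ θ s : ℝ} (hW : CoherentWindowPG ϑ aHi Λ θ s)
    (hC : CoherentGscCaccioppoliPG ϑ aHi Λ θ s) : TameGscCaccioppoliFloorPG ϑ aHi Λ θ s := by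
  intro δ hδ a ha Cg hCg
  obtain ⟨Cg', hCg', c₁, hc₁, κ, hκ, A, hA, r₀, hr₀, ϑ₁, hϑ₁, ω₁, hω₁, hK⟩ := hC δ hδ a ha Cg hCg
  refine ⟨Cg', hCg', c₁, hc₁, κ, hκ, A, hA, r₀, hr₀, fun K₀ hK₀ => ?_⟩
  obtain ⟨η₁, hη₁, R₁, hR₁, h1⟩ := hW ϑ₁ hϑ₁ ω₁ hω₁ δ hδ a ha Cg hCg K₀ hK₀
  obtain ⟨η₁', hη₁', R₁', hR₁', h2⟩ := hK K₀ hK₀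
  refine ⟨min η₁ η₁', lt_min hη₁ hη₁', max R₁ R₁', lt_max_of_lt_left hR₁, ?_⟩
  intro S hS hgood η hη hηle R hR L w hLw Ψ hΨ hfat htame
  exact h2 S hS hgood η hη (hηle.trans (min_le_right _ _)) R ((le_max_right _ _).trans hR) L w hLw Ψ hΨ hfat htame
    (h1 S hS hgood η hη (hηle.trans (min_le_left _ _)) R ((le_max_left _ _).trans hR) L w hLw Ψ hΨ hfat htame)

/-- **[CC°] ⇒ [CC°_W] (PROVED)** — the basin side is WEAKER than [CC°] (`ϑ₁ := ω₁ := 1`, the coherence hypothesis unused). [this file, g44] -/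
theorem coherentGscCaccioppoliPG_of_tameGscCaccioppoliFloorPG {ϑ aHi Λ θ s : ℝ} (h : TameGscCaccioppoliFloorPG ϑ aHi Λ θ s) :
    CoherentGscCaccioppoliPG ϑ aHi Λ θ s := by
  intro δ hδ a ha Cg hCg
  obtain ⟨Cg', hCg', c₁, hc₁, κ, hκ, A, hA, r₀, hr₀, hK⟩ := h δ hδ a ha Cg hCg
  refine ⟨Cg', hCg', c₁, hc₁, κ, hκ, A, hA, r₀, hr₀, 1, one_pos, 1, one_pos, fun K₀ hK₀ => ?_⟩
  obtain ⟨η₁, hη₁, R₁, hR₁, h1⟩ := hK K₀ hK₀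
  exact ⟨η₁, hη₁, R₁, hR₁, fun S hS hgood η hη hηle R hR L w hLw Ψ hΨ hfat htame _ =>
    h1 S hS hgood η hη hηle R hR L w hLw Ψ hΨ hfat htame⟩

/-! ### YD.5  The line down to [C] and (M) -/

/-- ★★★ **COROLLARY (PROVED): the coherent line down to [C]** — `[T] ∧ [KS] ∧ [W] ∧ [CC°_W] ⇒ [C] RigidCaccioppoliPG`. [this file, g44] -/
theorem rigidCaccioppoliPG_of_coherent_line {ϑ aHi Λ θ s : ℝ} (hT : TameWindowPG ϑ aHi Λ θ s) (hKS : KornSobolevPoincareP aHi θ)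
    (hW : CoherentWindowPG ϑ aHi Λ θ s) (hC : CoherentGscCaccioppoliPG ϑ aHi Λ θ s) : RigidCaccioppoliPG aHi Λ θ s :=
  rigidCaccioppoliPG_of_tame hT
    (tameRigidCaccioppoliPG_of_gscCaccioppoliFloor_of_kornSobolev hKS (tameGscCaccioppoliFloorPG_of_coherent hW hC))

/-- ★★★ **COROLLARY (PROVED): the coherent line down to (M)** — with the Gehring leaf (part UB): `[T] ∧ [KS] ∧ [W] ∧ [CC°_W] ∧ leaf ⇒
StrainNonConcentrationPG` (`aHi ≤ 8/7`). [this file, g44] -/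
theorem strainNonConcentrationPG_of_coherent_line {ϑ aHi Λ θ s : ℝ} (haHi : aHi ≤ 8 / 7) (hG : ZatorskaGoldstein2005_localGehringLemmaCounting)
    (hT : TameWindowPG ϑ aHi Λ θ s) (hKS : KornSobolevPoincareP aHi θ) (hW : CoherentWindowPG ϑ aHi Λ θ s)
    (hC : CoherentGscCaccioppoliPG ϑ aHi Λ θ s) : StrainNonConcentrationPG aHi Λ θ s :=
  strainNonConcentrationPG_of_rigidCaccioppoliPG haHi hG (rigidCaccioppoliPG_of_coherent_line hT hKS hW hC)

/-- Record example at the literals `(aHi; Λ, θ, s; ϑ) = (1; 2, 1/16, 1/50; tameRadius)`: the old residual [CC] still closes the line, via [CC°]. -/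
example (hT : TameWindowPG tameRadius 1 2 (1 / 16) (1 / 50)) (hKS : KornSobolevPoincareP 1 (1 / 16))
    (hCC : TameGscCaccioppoliPG tameRadius 1 2 (1 / 16) (1 / 50)) : RigidCaccioppoliPG 1 2 (1 / 16) (1 / 50) :=
  rigidCaccioppoliPG_of_tame hT (tameRigidCaccioppoliPG_of_gscCaccioppoliFloor_of_kornSobolev hKS
    (tameGscCaccioppoliFloorPG_of_tameGscCaccioppoliPG hCC))

/-- Record example at the same literals: the coherent pair [W] ∧ [CC°_W] closes the line ([T] ∧ [KS] ∧ [W] ∧ [CC°_W] ⇒ [C]). -/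
example (hT : TameWindowPG tameRadius 1 2 (1 / 16) (1 / 50)) (hKS : KornSobolevPoincareP 1 (1 / 16)) (hW : CoherentWindowPG tameRadius 1 2 (1 / 16) (1 / 50))
    (hC : CoherentGscCaccioppoliPG tameRadius 1 2 (1 / 16) (1 / 50)) : RigidCaccioppoliPG 1 2 (1 / 16) (1 / 50) :=
  rigidCaccioppoliPG_of_coherent_line hT hKS hW hC

end Summit.AtomisticToContinuum.Crystallization.Theorems.ChartedZeroExcessLayeredLatticeLiouville
end
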